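import Literature.MathematicalPhysics.QuantumFieldTheory.ConformalBootstrap3D.PointKernelK34v2Data

/-!
# K34v2 certificate, kernel block file H13: head segments `223 ≤ i < 230` (block-checked ones)

`decide` by kernel reduction (no `native_decide`, no extra axioms) of the block checker
`PCert.hBlockOK` of `PointKernel` on the literal data of `PointKernelK34v2Data` (cells checked corner
or chord by the rule bit); soundness is `PCert.hBlockOK_sound`.  Estimated kernel time 223 s
(5 theorems).
-/

set_option maxRecDepth 100000
set_option maxHeartbeats 0

namespace Literature.MathematicalPhysics.QuantumFieldTheory.ConformalBootstrap3D.PointKernelK34v2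

open Literature.MathematicalPhysics.QuantumFieldTheory.ConformalBootstrap3D.PointKernel

/-- head segment `[223, 224)` passes the kernel evaluator (≈41 s of kernel work). [folklore] -/
theorem hBlock_223 : certK34v2.hBlockOK hsegsK34v2 223 224 JHK34v2 = true := by
  decide +kernel

/-- head segments `[224, 226)` pass the kernel evaluator (≈46 s of kernel work). [folklore] -/
theorem hBlock_224 : certK34v2.hBlockOK hsegsK34v2 224 226 JHK34v2 = true := by
  decide +kernel

/-- head segments `[226, 228)` pass the kernel evaluator (≈46 s of kernel work). [folklore] -/
theorem hBlock_226 : certK34v2.hBlockOK hsegsK34v2 226 228 JHK34v2 = true := by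
  decide +kernel

/-- head segment `[228, 229)` passes the kernel evaluator (≈23 s of kernel work). [folklore] -/
theorem hBlock_228 : certK34v2.hBlockOK hsegsK34v2 228 229 JHK34v2 = true := by
  decide +kernel

/-- head segment `[229, 230)` passes the kernel evaluator (≈40 s of kernel work). [folklore] -/
theorem hBlock_229 : certK34v2.hBlockOK hsegsK34v2 229 230 JHK34v2 = true := by
  decide +kernel

end Literature.MathematicalPhysics.QuantumFieldTheory.ConformalBootstrap3D.PointKernelK34v2
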